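import Literature.NumberTheory.EllipticCurves.Kato2004.HullDescentSkeletonProofs
import Literature.NumberTheory.EllipticCurves.IwasawaAlgebraDivisibilityProofs
import HarnessLib

/-!
# Kato 2004, Conjecture 12.10 under a change of lattice `T' ⊂ T`: the six-term `Λ`-adic sequence of
# `0 → T' → T → C → 0` moves BOTH sides of the main conjecture by the same local lengths — as module
# theory over `ℤ_p⟦X⟧` (companion of `MainConjectureDescentSkeletonProofs` / `HullDescentSkeletonProofs`)

K. Kato, *`p`-adic Hodge theory and values of zeta functions of modular forms*, Astérisque **295**
(2004) [Kato2004Asterisque], Conj. 12.10 (p. 224): "Let `T` be a Gal(ℚ̄/ℚ)-stable `O_λ`-lattice of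
`V_{F_λ}(f)` and let `𝔭` be a prime ideal of `Λ` of height one … Then `Z(f,T)_𝔭 ⊂ 𝐇¹(T)_𝔭` and
`length_{Λ_𝔭}(𝐇²(T)_𝔭) = length_{Λ_𝔭}(𝐇¹(T)_𝔭/Z(f,T)_𝔭)`" — stated for EVERY stable lattice `T`. For
two lattices `T' ⊂ T` with finite quotient `C = T/T'` the `Λ`-adic cohomology sequence (8.2; `cd_p = 2`,
`𝐇⁰(C) = 0`) reads `0 → 𝐇¹(T') → 𝐇¹(T) → 𝐇¹(C) → 𝐇²(T') → 𝐇²(T) → 𝐇²(C) → 0`, and the zeta modules are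
`Z(f,T') = c · Z(f,T)` with `c = p^a`, `p^a = [T(−1)⁺ : T'(−1)⁺]` (Thm. 12.5 (1)–(2) / 14.5 (2): on the
trivial component `z_γ` depends only on `γ⁺ ∈ T(−1)⁺`). This file proves, as MODULE THEORY over
`Λ = ℤ_p⟦X⟧ = IwasawaAlgebra p` (Kato's objects as variables, as in the companion files), the
bookkeeping identity behind the lattice-independence of 12.10 — the `Λ`-adic form of the
isogeny-invariance of the main conjecture (for Selmer groups: Schneider, Perrin-Riou; Greenberg, LNM
1716, §4, uses the same six-term count for the invariance of the BSD prediction under isogeny):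

> **`Kato2004.lengthAt_latticeChange_identity`**: for an exact `0 → H' →f₁ H →g₁ X₁ →δ H2' →f₂ H2 →g₂ X₂ → 0`
> of `Λ`-modules and `z ∈ H`, `z' ∈ H'` with `f₁ z' = c • z` (`H` torsion free, `c ≠ 0`), at every prime `𝔮`:
> `ℓ_𝔮(H2) + ℓ_𝔮(X₁) + ℓ_𝔮(H'/Λz') = ℓ_𝔮(H2') + ℓ_𝔮(X₂) + ℓ_𝔮(H/Λz) + ℓ_𝔮(Λ/(c))`.

Hence (`Kato2004.lengthAt_eq_iff_of_latticeChange`), whenever the "Euler-characteristic identity"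
`ℓ_𝔮(X₁) = ℓ_𝔮(X₂) + ℓ_𝔮(Λ/(c))` holds at a height-one `𝔮` with these lengths finite (for `X₁ = 𝐇¹(C)⁰`,
`X₂ = 𝐇²(C)⁰` this is Tate's global Euler characteristic over the totally real layers `ℚ_n`:
`μ(𝐇¹(C)⁰) − μ(𝐇²(C)⁰) = ord_p #C⁻ = a` at `𝔮 = (p)`, and `0 = 0 + 0` off `(p)`), the equality of
Conj. 12.10 at `𝔮` holds for `(H, z, H2)` iff it holds for `(H', z', H2')`; likewise for the inequality
of Thm. 12.5 (4). Consumer (cell `bsd-potss`, seat `kmc`): `KMC_p(f_E)` as an invariant of the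
`ℚ`-isogeny class (`Summits/…/Additive/KatoDescentLatticeChange.lean`). Theorems only; no definition, no
named fact; nothing about Kato's objects is asserted.

References: [Kato2004Asterisque] 8.2 (pp. 180–181), Thm. 12.5 (1)–(2) (p. 221), Conj. 12.10 (p. 224),
Thm. 14.5 (2) (p. 236); [GreenbergLNM1716] §4 (invariance of the BSD prediction under isogeny);
[NeukirchSchmidtWingberg2008] (8.7.4) (global Euler–Poincaré characteristic).
-/

noncomputable section

open scoped Classical

universe u

namespace Literature.NumberTheory.EllipticCurves.Kato2004

open Literature.NumberTheory.EllipticCurves.IwasawaAlgebra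

variable {p : ℕ} [Fact p.Prime]

/-! ### §1 Change of generator at the level of local lengths -/

section Generator

variable {H : Type u} [AddCommGroup H] [Module (IwasawaAlgebra p) H]
  [NoZeroSMulDivisors (IwasawaAlgebra p) H]

/-- **`ℓ_𝔮(H/Λ(c·z)) = ℓ_𝔮(H/Λz) + ℓ_𝔮(Λ/(c))`** for `H` torsion free, `z ≠ 0`: the local length along
`0 → Λz/Λcz ≅ Λ/(c) → H/Λcz → H/Λz → 0` (any prime `𝔮`). [cite: Kato2004Asterisque, definition of `[M : z]` (pp. 236–237)] -/
theorem lengthAt_quotient_span_smul {c : IwasawaAlgebra p} (z : H) (hz : z ≠ 0)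
    (𝔮 : PrimeSpectrum (IwasawaAlgebra p)) :
    Module.lengthAt (IwasawaAlgebra p) (H ⧸ (IwasawaAlgebra p) ∙ (c • z)) 𝔮 =
      Module.lengthAt (IwasawaAlgebra p) (H ⧸ (IwasawaAlgebra p) ∙ z) 𝔮 +
        Module.lengthAt (IwasawaAlgebra p) (IwasawaAlgebra p ⧸ Ideal.span {c}) 𝔮 := by
  set Zc : Submodule (IwasawaAlgebra p) H := (IwasawaAlgebra p) ∙ (c • z) with hZc
  set Z : Submodule (IwasawaAlgebra p) H := (IwasawaAlgebra p) ∙ z with hZ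
  have hle : Zc ≤ Z := by
    rw [hZc, Submodule.span_singleton_le_iff_mem]
    exact Submodule.smul_mem _ c (Submodule.mem_span_singleton_self z)
  set M' : Submodule (IwasawaAlgebra p) (H ⧸ Zc) := Z.map Zc.mkQ with hM'
  set φ : IwasawaAlgebra p →ₗ[IwasawaAlgebra p] H ⧸ Zc :=
    Zc.mkQ.comp (LinearMap.toSpanSingleton (IwasawaAlgebra p) H z) with hφ
  have hrange : LinearMap.range φ = M' := by
    rw [hφ, LinearMap.range_comp, ← LinearMap.span_singleton_eq_range, hM', hZ]
  have hker : LinearMap.ker φ = Ideal.span {c} := by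
    ext a
    rw [LinearMap.mem_ker, hφ, LinearMap.comp_apply, LinearMap.toSpanSingleton_apply,
      Submodule.mkQ_apply, Submodule.Quotient.mk_eq_zero, hZc, Submodule.mem_span_singleton,
      Ideal.mem_span_singleton']
    constructor
    · rintro ⟨b, hb⟩
      refine ⟨b, ?_⟩
      have h0 : (b * c - a) • z = 0 := by rw [sub_smul, mul_smul, hb, sub_self]
      rcases smul_eq_zero.mp h0 with h0 | h0
      · exact (sub_eq_zero.mp h0)
      · exact absurd h0 hz
    · rintro ⟨b, rfl⟩
      exact ⟨b, by rw [mul_smul]⟩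
  have eM' : (IwasawaAlgebra p ⧸ Ideal.span {c}) ≃ₗ[IwasawaAlgebra p] M' :=
    ((Submodule.quotEquivOfEq _ _ hker).symm.trans φ.quotKerEquivRange).trans
      (LinearEquiv.ofEq _ _ hrange)
  set ψ : (H ⧸ Zc) →ₗ[IwasawaAlgebra p] H ⧸ Z := Submodule.factor hle with hψ
  have hψ_surj : Function.Surjective ψ := by
    intro q
    obtain ⟨x, rfl⟩ := Submodule.Quotient.mk_surjective _ q
    exact ⟨Submodule.Quotient.mk x, rfl⟩
  have hkerψ : LinearMap.ker ψ = M' := by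
    ext q
    induction q using Submodule.Quotient.induction_on with
    | H x =>
      rw [LinearMap.mem_ker]
      change Submodule.Quotient.mk (p := Z) x = 0 ↔ _
      rw [Submodule.Quotient.mk_eq_zero, hM']
      constructor
      · intro hx
        exact ⟨x, hx, rfl⟩
      · rintro ⟨x', hx', hxx'⟩
        rw [Submodule.mkQ_apply, Submodule.Quotient.eq] at hxx'
        have : x = x' - (x' - x) := by abel
        rw [this]
        exact Z.sub_mem hx' (hle hxx')
  have hex : Function.Exact M'.subtype ψ := by
    rw [LinearMap.exact_iff, hkerψ, Submodule.range_subtype]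
  rw [Module.lengthAt_eq_add_of_exact M'.subtype ψ (Submodule.subtype_injective _) hψ_surj hex 𝔮,
    ← Module.lengthAt_eq_of_linearEquiv eM', add_comm]

end Generator

/-! ### §2 The six-term identity -/

section Hexagon

variable {H' H X₁ H2' H2 X₂ : Type u}
  [AddCommGroup H'] [Module (IwasawaAlgebra p) H'] [AddCommGroup H] [Module (IwasawaAlgebra p) H]
  [AddCommGroup X₁] [Module (IwasawaAlgebra p) X₁] [AddCommGroup H2'] [Module (IwasawaAlgebra p) H2']
  [AddCommGroup H2] [Module (IwasawaAlgebra p) H2] [AddCommGroup X₂] [Module (IwasawaAlgebra p) X₂]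
  [NoZeroSMulDivisors (IwasawaAlgebra p) H]

/-- **The lattice-change identity.** For an exact sequence of `Λ`-modules
`0 → H' →f₁ H →g₁ X₁ →δ H2' →f₂ H2 →g₂ X₂ → 0` (`𝐇¹(T') → 𝐇¹(T) → 𝐇¹(C) → 𝐇²(T') → 𝐇²(T) → 𝐇²(C) → 0`,
Kato 8.2), `H` torsion free, `z ∈ H` non-zero and `z' ∈ H'` with `f₁ z' = c • z` (`Z(f,T') = c·Z(f,T)`),
at EVERY prime `𝔮`:
**`ℓ_𝔮(H2) + ℓ_𝔮(X₁) + ℓ_𝔮(H'/Λz') = ℓ_𝔮(H2') + ℓ_𝔮(X₂) + ℓ_𝔮(H/Λz) + ℓ_𝔮(Λ/(c))`** (in `ℕ∞`; no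
finiteness needed). Proof: `ℓ(H2') = ℓ(ker f₂) + ℓ(im f₂)`, `ℓ(H2) = ℓ(im f₂) + ℓ(X₂)`,
`ℓ(X₁) = ℓ(H/f₁H') + ℓ(ker f₂)`, `ℓ(H/Λcz) = ℓ(H/Λz) + ℓ(Λ/(c)) = ℓ(H/f₁H') + ℓ(H'/Λz')`.
[cite: Kato2004Asterisque, Conj. 12.10 (p. 224), 8.2 (pp. 180–181)] [cite: GreenbergLNM1716, §4] -/
theorem lengthAt_latticeChange_identity (f₁ : H' →ₗ[IwasawaAlgebra p] H)
    (g₁ : H →ₗ[IwasawaAlgebra p] X₁) (δ : X₁ →ₗ[IwasawaAlgebra p] H2')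
    (f₂ : H2' →ₗ[IwasawaAlgebra p] H2) (g₂ : H2 →ₗ[IwasawaAlgebra p] X₂)
    (hf₁ : Function.Injective f₁) (h₁ : Function.Exact f₁ g₁) (h₂ : Function.Exact g₁ δ)
    (h₃ : Function.Exact δ f₂) (h₄ : Function.Exact f₂ g₂) (hg₂ : Function.Surjective g₂)
    {c : IwasawaAlgebra p} (z : H) (hz : z ≠ 0) (z' : H') (hzz' : f₁ z' = c • z)
    (𝔮 : PrimeSpectrum (IwasawaAlgebra p)) :
    Module.lengthAt (IwasawaAlgebra p) H2 𝔮 + Module.lengthAt (IwasawaAlgebra p) X₁ 𝔮 +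
        Module.lengthAt (IwasawaAlgebra p) (H' ⧸ (IwasawaAlgebra p) ∙ z') 𝔮 =
      Module.lengthAt (IwasawaAlgebra p) H2' 𝔮 + Module.lengthAt (IwasawaAlgebra p) X₂ 𝔮 +
        Module.lengthAt (IwasawaAlgebra p) (H ⧸ (IwasawaAlgebra p) ∙ z) 𝔮 +
        Module.lengthAt (IwasawaAlgebra p) (IwasawaAlgebra p ⧸ Ideal.span {c}) 𝔮 := by
  -- (A) `ℓ(H2) + ℓ(ker f₂) = ℓ(H2') + ℓ(X₂)`
  have hA : Module.lengthAt (IwasawaAlgebra p) H2 𝔮 +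
      Module.lengthAt (IwasawaAlgebra p) (LinearMap.ker f₂) 𝔮 =
      Module.lengthAt (IwasawaAlgebra p) H2' 𝔮 + Module.lengthAt (IwasawaAlgebra p) X₂ 𝔮 := by
    have e1 : (H2' ⧸ LinearMap.ker f₂) ≃ₗ[IwasawaAlgebra p] LinearMap.range f₂ := f₂.quotKerEquivRange
    have hH2' : Module.lengthAt (IwasawaAlgebra p) H2' 𝔮 =
        Module.lengthAt (IwasawaAlgebra p) (LinearMap.ker f₂) 𝔮 +
          Module.lengthAt (IwasawaAlgebra p) (LinearMap.range f₂) 𝔮 := by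
      rw [Module.lengthAt_eq_add_quotient (LinearMap.ker f₂) 𝔮, Module.lengthAt_eq_of_linearEquiv e1]
    have e2 : (H2 ⧸ LinearMap.range f₂) ≃ₗ[IwasawaAlgebra p] X₂ :=
      (Submodule.quotEquivOfEq _ _ (LinearMap.exact_iff.mp h₄).symm).trans
        (g₂.quotKerEquivOfSurjective hg₂)
    have hH2 : Module.lengthAt (IwasawaAlgebra p) H2 𝔮 =
        Module.lengthAt (IwasawaAlgebra p) (LinearMap.range f₂) 𝔮 +
          Module.lengthAt (IwasawaAlgebra p) X₂ 𝔮 := by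
      rw [Module.lengthAt_eq_add_quotient (LinearMap.range f₂) 𝔮, Module.lengthAt_eq_of_linearEquiv e2]
    rw [hH2, hH2']
    ring
  -- (B) `ℓ(X₁) = ℓ(H/range f₁) + ℓ(ker f₂)`
  have hB : Module.lengthAt (IwasawaAlgebra p) X₁ 𝔮 =
      Module.lengthAt (IwasawaAlgebra p) (H ⧸ LinearMap.range f₁) 𝔮 +
        Module.lengthAt (IwasawaAlgebra p) (LinearMap.ker f₂) 𝔮 := by
    have e3 : (H ⧸ LinearMap.range f₁) ≃ₗ[IwasawaAlgebra p] LinearMap.range g₁ :=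
      (Submodule.quotEquivOfEq _ _ (LinearMap.exact_iff.mp h₁).symm).trans g₁.quotKerEquivRange
    have e4 : (X₁ ⧸ LinearMap.range g₁) ≃ₗ[IwasawaAlgebra p] LinearMap.ker f₂ :=
      ((Submodule.quotEquivOfEq _ _ (LinearMap.exact_iff.mp h₂).symm).trans δ.quotKerEquivRange).trans
        (LinearEquiv.ofEq _ _ (LinearMap.exact_iff.mp h₃).symm)
    rw [Module.lengthAt_eq_add_quotient (LinearMap.range g₁) 𝔮, ← Module.lengthAt_eq_of_linearEquiv e3,
      Module.lengthAt_eq_of_linearEquiv e4]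
  -- (C) `ℓ(H/Λz) + ℓ(Λ/(c)) = ℓ(H/Λcz) = ℓ(H'/Λz') + ℓ(H/range f₁)`
  have hC : Module.lengthAt (IwasawaAlgebra p) (H ⧸ (IwasawaAlgebra p) ∙ z) 𝔮 +
      Module.lengthAt (IwasawaAlgebra p) (IwasawaAlgebra p ⧸ Ideal.span {c}) 𝔮 =
      Module.lengthAt (IwasawaAlgebra p) (H' ⧸ (IwasawaAlgebra p) ∙ z') 𝔮 +
        Module.lengthAt (IwasawaAlgebra p) (H ⧸ LinearMap.range f₁) 𝔮 := by
    rw [← lengthAt_quotient_span_smul z hz 𝔮]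
    set Zc : Submodule (IwasawaAlgebra p) H := (IwasawaAlgebra p) ∙ (c • z) with hZc
    have hZc_le : Zc ≤ LinearMap.range f₁ := by
      rw [hZc, Submodule.span_singleton_le_iff_mem, ← hzz']
      exact LinearMap.mem_range_self f₁ z'
    set M' : Submodule (IwasawaAlgebra p) (H ⧸ Zc) := (LinearMap.range f₁).map Zc.mkQ with hM'
    -- `(H/Λcz)/M' ≅ H / range f₁`
    have e5 : ((H ⧸ Zc) ⧸ M') ≃ₗ[IwasawaAlgebra p] H ⧸ LinearMap.range f₁ :=
      (Submodule.quotientQuotientEquivQuotientSup Zc (LinearMap.range f₁)).trans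
        (Submodule.quotEquivOfEq _ _ (sup_eq_right.mpr hZc_le))
    -- `M' ≅ H'/Λz'` via `f₁`
    have hcomap : ((IwasawaAlgebra p) ∙ z') ≤ Zc.comap f₁ := by
      rw [Submodule.span_singleton_le_iff_mem, Submodule.mem_comap, hzz', hZc]
      exact Submodule.mem_span_singleton_self _
    set θ : (H' ⧸ (IwasawaAlgebra p) ∙ z') →ₗ[IwasawaAlgebra p] H ⧸ Zc :=
      Submodule.mapQ _ Zc f₁ hcomap with hθ
    have hmapz : ((IwasawaAlgebra p) ∙ z').map f₁ = Zc := by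
      rw [Submodule.map_span, Set.image_singleton, hzz']
    have hθ_inj : Function.Injective θ := by
      rw [← LinearMap.ker_eq_bot, hθ, Submodule.mapQ, Submodule.ker_liftQ, LinearMap.ker_comp,
        Submodule.ker_mkQ, ← hmapz, Submodule.comap_map_eq, LinearMap.ker_eq_bot.mpr hf₁, sup_bot_eq,
        Submodule.mkQ_map_self]
    have hθ_range : LinearMap.range θ = M' := by
      rw [hθ, Submodule.mapQ, Submodule.range_liftQ, LinearMap.range_comp, hM']
    have e6 : (H' ⧸ (IwasawaAlgebra p) ∙ z') ≃ₗ[IwasawaAlgebra p] M' :=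
      (LinearEquiv.ofInjective θ hθ_inj).trans (LinearEquiv.ofEq _ _ hθ_range)
    rw [Module.lengthAt_eq_add_quotient M' 𝔮, ← Module.lengthAt_eq_of_linearEquiv e6,
      Module.lengthAt_eq_of_linearEquiv e5]
  -- assemble
  calc Module.lengthAt (IwasawaAlgebra p) H2 𝔮 + Module.lengthAt (IwasawaAlgebra p) X₁ 𝔮 +
        Module.lengthAt (IwasawaAlgebra p) (H' ⧸ (IwasawaAlgebra p) ∙ z') 𝔮
      = (Module.lengthAt (IwasawaAlgebra p) H2 𝔮 +
          Module.lengthAt (IwasawaAlgebra p) (LinearMap.ker f₂) 𝔮) +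
        (Module.lengthAt (IwasawaAlgebra p) (H' ⧸ (IwasawaAlgebra p) ∙ z') 𝔮 +
          Module.lengthAt (IwasawaAlgebra p) (H ⧸ LinearMap.range f₁) 𝔮) := by rw [hB]; ring
    _ = (Module.lengthAt (IwasawaAlgebra p) H2' 𝔮 + Module.lengthAt (IwasawaAlgebra p) X₂ 𝔮) +
        (Module.lengthAt (IwasawaAlgebra p) (H ⧸ (IwasawaAlgebra p) ∙ z) 𝔮 +
          Module.lengthAt (IwasawaAlgebra p) (IwasawaAlgebra p ⧸ Ideal.span {c}) 𝔮) := by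
        rw [hA, hC]
    _ = _ := by ring

/-- **Lattice-independence of the main conjecture at a height-one prime (Conj. 12.10 for `T` ⟺ for
`T'`), granted the Euler-characteristic identity `ℓ_𝔮(X₁) = ℓ_𝔮(X₂) + ℓ_𝔮(Λ/(c))`** (for
`X₁ = 𝐇¹(C)⁰`, `X₂ = 𝐇²(C)⁰`, `c = p^a` with `p^a = [T(−1)⁺ : T'(−1)⁺] = #C⁻`: Tate's global Euler
characteristic over the totally real `ℚ_n` at `𝔮 = (p)`, `0 = 0` off `(p)`). All modules finitely
generated torsion (lengths finite at the height-one `𝔮`). Same data as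
`lengthAt_latticeChange_identity`. [cite: Kato2004Asterisque, Conj. 12.10 (p. 224)] [cite: NeukirchSchmidtWingberg2008, (8.7.4)] -/
theorem lengthAt_eq_iff_of_latticeChange (f₁ : H' →ₗ[IwasawaAlgebra p] H)
    (g₁ : H →ₗ[IwasawaAlgebra p] X₁) (δ : X₁ →ₗ[IwasawaAlgebra p] H2')
    (f₂ : H2' →ₗ[IwasawaAlgebra p] H2) (g₂ : H2 →ₗ[IwasawaAlgebra p] X₂)
    (hf₁ : Function.Injective f₁) (h₁ : Function.Exact f₁ g₁) (h₂ : Function.Exact g₁ δ)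
    (h₃ : Function.Exact δ f₂) (h₄ : Function.Exact f₂ g₂) (hg₂ : Function.Surjective g₂)
    {c : IwasawaAlgebra p} (hc : c ≠ 0) (z : H) (hz : z ≠ 0) (z' : H') (hzz' : f₁ z' = c • z)
    [Module.Finite (IwasawaAlgebra p) H] [Module.Finite (IwasawaAlgebra p) H']
    [Module.Finite (IwasawaAlgebra p) H2] [Module.Finite (IwasawaAlgebra p) H2']
    [Module.Finite (IwasawaAlgebra p) X₂]
    (hHZ : Module.IsTorsion (IwasawaAlgebra p) (H ⧸ (IwasawaAlgebra p) ∙ z))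
    (hHZ' : Module.IsTorsion (IwasawaAlgebra p) (H' ⧸ (IwasawaAlgebra p) ∙ z'))
    (hH2 : Module.IsTorsion (IwasawaAlgebra p) H2) (hH2' : Module.IsTorsion (IwasawaAlgebra p) H2')
    (hX₂ : Module.IsTorsion (IwasawaAlgebra p) X₂)
    (𝔮 : PrimeSpectrum (IwasawaAlgebra p)) (h𝔮 : 𝔮.asIdeal.height = 1)
    (hEC : Module.lengthAt (IwasawaAlgebra p) X₁ 𝔮 =
      Module.lengthAt (IwasawaAlgebra p) X₂ 𝔮 +
        Module.lengthAt (IwasawaAlgebra p) (IwasawaAlgebra p ⧸ Ideal.span {c}) 𝔮) :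
    (Module.lengthAt (IwasawaAlgebra p) H2 𝔮 =
        Module.lengthAt (IwasawaAlgebra p) (H ⧸ (IwasawaAlgebra p) ∙ z) 𝔮 ↔
      Module.lengthAt (IwasawaAlgebra p) H2' 𝔮 =
        Module.lengthAt (IwasawaAlgebra p) (H' ⧸ (IwasawaAlgebra p) ∙ z') 𝔮) ∧
    (Module.lengthAt (IwasawaAlgebra p) H2 𝔮 ≤
        Module.lengthAt (IwasawaAlgebra p) (H ⧸ (IwasawaAlgebra p) ∙ z) 𝔮 ↔
      Module.lengthAt (IwasawaAlgebra p) H2' 𝔮 ≤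
        Module.lengthAt (IwasawaAlgebra p) (H' ⧸ (IwasawaAlgebra p) ∙ z') 𝔮) := by
  have hid := lengthAt_latticeChange_identity f₁ g₁ δ f₂ g₂ hf₁ h₁ h₂ h₃ h₄ hg₂ z hz z' hzz' 𝔮
  rw [hEC] at hid
  -- all lengths are finite: name them as natural numbers
  have hle1 : 𝔮.asIdeal.height ≤ 1 := le_of_eq h𝔮
  have hΛc : Module.IsTorsion (IwasawaAlgebra p) (IwasawaAlgebra p ⧸ Ideal.span {c}) := by
    intro x
    refine ⟨⟨c, mem_nonZeroDivisors_of_ne_zero hc⟩, ?_⟩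
    induction x using Submodule.Quotient.induction_on with
    | H a =>
      rw [Submonoid.smul_def]
      change c • Submodule.Quotient.mk (p := Ideal.span {c}) a = 0
      rw [← Submodule.Quotient.mk_smul, Submodule.Quotient.mk_eq_zero, smul_eq_mul]
      exact Ideal.mem_span_singleton'.mpr ⟨a, mul_comm a c⟩
  obtain ⟨n2, hn2⟩ := ENat.ne_top_iff_exists.mp (IwasawaAlgebra.lengthAt_ne_top_of_isTorsion H2 hH2 𝔮 hle1)
  obtain ⟨n2', hn2'⟩ := ENat.ne_top_iff_exists.mp (IwasawaAlgebra.lengthAt_ne_top_of_isTorsion H2' hH2' 𝔮 hle1)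
  obtain ⟨nX, hnX⟩ := ENat.ne_top_iff_exists.mp (IwasawaAlgebra.lengthAt_ne_top_of_isTorsion X₂ hX₂ 𝔮 hle1)
  obtain ⟨nZ, hnZ⟩ := ENat.ne_top_iff_exists.mp
    (IwasawaAlgebra.lengthAt_ne_top_of_isTorsion (H ⧸ (IwasawaAlgebra p) ∙ z) hHZ 𝔮 hle1)
  obtain ⟨nZ', hnZ'⟩ := ENat.ne_top_iff_exists.mp
    (IwasawaAlgebra.lengthAt_ne_top_of_isTorsion (H' ⧸ (IwasawaAlgebra p) ∙ z') hHZ' 𝔮 hle1)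
  obtain ⟨nc, hnc⟩ := ENat.ne_top_iff_exists.mp
    (IwasawaAlgebra.lengthAt_ne_top_of_isTorsion (IwasawaAlgebra p ⧸ Ideal.span {c}) hΛc 𝔮 hle1)
  rw [← hn2, ← hn2', ← hnX, ← hnZ, ← hnZ', ← hnc] at hid
  rw [← hn2, ← hn2', ← hnZ, ← hnZ']
  have hid' : n2 + (nX + nc) + nZ' = n2' + nX + nZ + nc := by exact_mod_cast hid
  refine ⟨?_, ?_⟩
  · rw [Nat.cast_inj, Nat.cast_inj]; omega
  · rw [Nat.cast_le, Nat.cast_le]; omega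

end Hexagon

end Literature.NumberTheory.EllipticCurves.Kato2004

end
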